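/-
Uniform value line: typed theorems in the polynomial weighted-centre model `W(f)` of the pub-rosobs cell —
NOT a resolution theorem and NOT a statement about the invariant of [AbramovichTemkinWlodarczyk2024] on power series.
AI review is weaker than expert review.
-/
import Literature.AlgebraicGeometry.Resolution.WeightedCentreTwistDepth
import Literature.AlgebraicGeometry.Resolution.WeightedCentreConjugation
import Mathlib.Algebra.MvPolynomial.Monad
import HarnessLib

/-!
# No pure translation at a maximal centre (engine 1, g30 LEMMA ND0, in the `W(f)` model)

Engine 1 of the pub-rosobs cell (gen 30, `THEOREM-T9-eng1-g30.md` §2, LEMMA ND0 "no depth-0 absorber") observes that at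
a centre attaining `max W(f)` in inverse normal form no slot of weight exactly `θ` can be SHIFTED: if the maximal-rate
part of some coordinate is a pure translate `ε_b + c·t` (`c ≠ 0`), substitute `t ↦ −ε_b/c` into the face equation
`h₀(ε + A(t, ε)) = h₀(ε)`; this exhibits `h₀ = G(ε'')` with `G = h₀|_{ε_b = 0}` and `ε''_i = ε_i + A_i(−ε_b/c, ε)` a
GRADED UNIPOTENT (triangular) coordinate change, so in the new coordinates the face has no monomial through `ε_b` —
contradicting the upper pin of `b` forced by maximality (`exists_upperPin_of_isMaxInv`, engine 1's L3).

This file types that argument over an arbitrary field, in the tree's conventions (`t = X_a`, the shifted slot `b`):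

* §0 plumbing.
* §1 **Triangular automorphisms**: `triangularEquiv N rk h` — for a correction family `N` that is triangular for a rank
  function (`vars (N i)` have rank `< rk i`) the substitution `X_i ↦ X_i + N_i` is a `k`-algebra automorphism,
  built as the composition of the block shears (`blockShear`, `WeightedCentreConjugation`) of the rank levels,
  lowest level first (`triangularEquiv_X`).
* §2 **Graded automorphisms**: an algebra map sending every `X_j` to a `W`-homogeneous polynomial of degree `W j`
  commutes with the homogeneous components (`weightedHomogeneousComponent_algHom_comm`), and the inverse of such an
  automorphism is again graded (`isWeightedHomogeneous_algEquiv_symm_X`).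
* §3 **The ND0 correction family** `pureCorrection a b c D Y`: `N_i = (θ_Y i − X_i)(t := −X_b/c)` off `{a, b}` —
  `t`-free, every monomial through `X_b`, `D`-homogeneous of degree `D_i`, triangular for `ndRank b D`.
* §4 **THEOREM ND0 in the model** (`eq_zero_of_top_eq_pure_translation`): for a centre of `X_a^q + h` attaining
  `max W(f)`, in inverse normal form, dominating the θ-grading and not `T`-tight (`qθ > 1`), a maximal-rate part of
  the shape `X_b + c·X_a` forces `c = 0`.

Value type: typed lemmas in the polynomial `W(f)` model — not a resolution theorem.  Over every field; the positive
characteristic enters only through the hypotheses (the face equation it is fed by).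

References: [AbramovichTemkinWlodarczyk2024] Lemma 5.2.10 (p. 1577), Thm. 5.3.1 (2) (p. 1578), §5.1 (p. 1575);
[CossartJannsenSaito2020] Def. 8.2 / Thm. 8.16 (coordinate changes `y ↦ y + q(u)`), §2.2 (p. 21);
[Hauser2010] §D (p. 12) (translational moves in positive characteristic); [AbramovichQuekSchober2025] Thm. 3.5.
-/

noncomputable section

open MvPolynomial
open Finsupp (weight)

namespace Literature.AlgebraicGeometry.Resolution

namespace WeightedBlowup

variable {k : Type*} [Field k] {N : ℕ}

/-! ## §0 Plumbing -/

/-- A variable absent from `P` has exponent `0` in every monomial of `P` (plumbing). [folklore] -/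
private theorem apply_eq_zero_of_notMem_vars₄₇ {P : MvPolynomial (Fin N) k} {a : Fin N} (hP : a ∉ P.vars)
    {β : Fin N →₀ ℕ} (hβ : β ∈ P.support) : β a = 0 := by
  by_contra hne
  exact hP ((mem_vars_iff_mem_support a).mpr ⟨β, hβ, Finsupp.mem_support_iff.mpr hne⟩)

/-- The layers of a polynomial free of `X_a` are free of `X_a` (plumbing). [folklore] -/
private theorem notMem_vars_weightedHomogeneousComponent₄₇ {a : Fin N} {P : MvPolynomial (Fin N) k}
    (hP : a ∉ P.vars) (D : Fin N → ℕ) (m : ℕ) : a ∉ (weightedHomogeneousComponent D m P).vars := by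
  classical
  intro ha
  obtain ⟨d, hd, had⟩ := (mem_vars_iff_mem_support a).mp ha
  rw [mem_support_iff, coeff_weightedHomogeneousComponent] at hd
  split_ifs at hd with hw
  · exact Finsupp.mem_support_iff.mp had (apply_eq_zero_of_notMem_vars₄₇ hP (mem_support_iff.mpr hd))
  · exact hd rfl

/-- Two substitutions that agree on the variables of `P` agree on `P` (plumbing). [folklore] -/
private theorem aeval_congr_vars₄₇ (G G' : Fin N → MvPolynomial (Fin N) k) {P : MvPolynomial (Fin N) k}
    (hG : ∀ i ∈ P.vars, G i = G' i) : aeval G P = aeval G' P := by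
  change (aeval G : MvPolynomial (Fin N) k →ₐ[k] MvPolynomial (Fin N) k).toRingHom P =
    (aeval G' : MvPolynomial (Fin N) k →ₐ[k] MvPolynomial (Fin N) k).toRingHom P
  refine hom_congr_vars ?_ (fun i hi _ => ?_) rfl
  · ext r
    simp
  · change aeval G (X i) = aeval G' (X i)
    rw [aeval_X, aeval_X, hG i hi]

/-- A substitution fixing the variables of `P` fixes `P` (plumbing). [folklore] -/
private theorem aeval_eq_self_of_vars₄₇ (G : Fin N → MvPolynomial (Fin N) k) {P : MvPolynomial (Fin N) k}
    (hG : ∀ i ∈ P.vars, G i = X i) : aeval G P = P := by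
  rw [aeval_congr_vars₄₇ G X hG, aeval_X_left_apply]

/-- An algebra automorphism of `k[X]` is the substitution of its values on the variables (plumbing). [folklore] -/
private theorem algEquiv_eq_aeval₄₇ (Λ : MvPolynomial (Fin N) k ≃ₐ[k] MvPolynomial (Fin N) k)
    (P : MvPolynomial (Fin N) k) : Λ P = aeval (fun i => Λ (X i)) P :=
  AlgHom.congr_fun (aeval_unique (Λ : MvPolynomial (Fin N) k →ₐ[k] MvPolynomial (Fin N) k)) P

/-- `Λ (P(G)) = P(Λ ∘ G)` for an algebra automorphism `Λ` (plumbing). [folklore] -/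
private theorem algEquiv_aeval₄₇ (Λ : MvPolynomial (Fin N) k ≃ₐ[k] MvPolynomial (Fin N) k)
    (G : Fin N → MvPolynomial (Fin N) k) (P : MvPolynomial (Fin N) k) :
    Λ (aeval G P) = aeval (fun i => Λ (G i)) P :=
  comp_aeval_apply G (Λ : MvPolynomial (Fin N) k →ₐ[k] MvPolynomial (Fin N) k) P

/-- An algebra map sending every variable to a polynomial without constant term preserves constant coefficients
(plumbing). [folklore] -/
private theorem constantCoeff_map₄₇ {F : Type*} [FunLike F (MvPolynomial (Fin N) k) (MvPolynomial (Fin N) k)]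
    [AlgHomClass F k (MvPolynomial (Fin N) k) (MvPolynomial (Fin N) k)] (φ : F)
    (hφ : ∀ j, constantCoeff (φ (X j)) = 0) (P : MvPolynomial (Fin N) k) :
    constantCoeff (φ P) = constantCoeff P := by
  have key : (constantCoeff : MvPolynomial (Fin N) k →+* k).comp (φ : MvPolynomial (Fin N) k →+* MvPolynomial (Fin N) k)
      = constantCoeff := by
    refine ringHom_ext (fun r => ?_) (fun j => ?_)
    · rw [RingHom.comp_apply, RingHom.coe_coe]
      have h : φ (C r) = C r := by
        have h' := AlgHomClass.commutes φ r
        rwa [MvPolynomial.algebraMap_eq] at h'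
      rw [h]
    · rw [RingHom.comp_apply, RingHom.coe_coe, hφ j, constantCoeff_X]
  have h := RingHom.congr_fun key P
  rwa [RingHom.comp_apply, RingHom.coe_coe] at h

/-- The `t`-degree grading: weight `1` on `X_a`, `0` elsewhere (plumbing). [folklore] -/
private def tIndicator (a : Fin N) : Fin N → ℕ := fun j => if j = a then 1 else 0

/-- The `t`-degree of a monomial is its exponent at `a` (plumbing). [folklore] -/
private theorem weight_tIndicator (a : Fin N) (d : Fin N →₀ ℕ) : weight (tIndicator a) d = d a := by
  classical
  rw [Finsupp.weight_apply, Finsupp.sum]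
  simp only [tIndicator, smul_eq_mul, mul_ite, mul_one, mul_zero]
  rw [Finset.sum_ite_eq']
  split_ifs with h
  · rfl
  · exact (Finsupp.notMem_support_iff.mp h).symm

/-! ## §1 Triangular automorphisms -/

section Triangular

variable (Nf : Fin N → MvPolynomial (Fin N) k) (rk : Fin N → ℕ)

/-- The slots of rank `n`. (derived here) [cite: CossartJannsenSaito2020, Def. 8.2 / Thm. 8.16] -/
def rankLevel (n : ℕ) : Finset (Fin N) := Finset.univ.filter fun i => rk i = n

/-- Membership in a rank level. (derived here) [cite: CossartJannsenSaito2020, Def. 8.2] -/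
theorem mem_rankLevel {n : ℕ} {i : Fin N} : i ∈ rankLevel rk n ↔ rk i = n := by
  simp [rankLevel]

/-- For a triangular correction family (`vars (N i)` of rank `< rk i`) no `N i` with `i` of rank `n` involves a
variable of rank `n` — the block-shear hypothesis of a rank level. (derived here)
[cite: CossartJannsenSaito2020, Def. 8.2 / Thm. 8.16] -/
theorem rankLevel_blockShear_cond (hrk : ∀ i, ∀ j ∈ (Nf i).vars, rk j < rk i) (n : ℕ) :
    ∀ i ∈ rankLevel rk n, ∀ j ∈ (Nf i).vars, j ∉ rankLevel rk n := by
  intro i hi j hj hjn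
  rw [mem_rankLevel] at hi hjn
  have := hrk i j hj
  omega

/-- **Triangular automorphism up to rank `n`**: the composition of the block shears `X_i ↦ X_i + N_i` of the rank
levels `0, 1, …, n − 1`, lowest level FIRST (so that the sequential substitution equals the simultaneous one).
(derived here) [cite: CossartJannsenSaito2020, Def. 8.2 / Thm. 8.16] [cite: AbramovichTemkinWlodarczyk2024, Lemma 5.2.10 (p. 1577)] -/
def triangularUpTo (hrk : ∀ i, ∀ j ∈ (Nf i).vars, rk j < rk i) :
    ℕ → (MvPolynomial (Fin N) k ≃ₐ[k] MvPolynomial (Fin N) k)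
  | 0 => AlgEquiv.refl
  | n + 1 => (triangularUpTo hrk n).trans (blockShear (rankLevel rk n) Nf (rankLevel_blockShear_cond Nf rk hrk n))

/-- `triangularUpTo n` is the simultaneous substitution `X_m ↦ X_m + N_m` on the slots of rank `< n` and the identity
on the others. (derived here) [cite: CossartJannsenSaito2020, Def. 8.2 / Thm. 8.16] -/
theorem triangularUpTo_X (hrk : ∀ i, ∀ j ∈ (Nf i).vars, rk j < rk i) (n : ℕ) (m : Fin N) :
    triangularUpTo Nf rk hrk n (X m) = if rk m < n then X m + Nf m else X m := by
  induction n with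
  | zero => simp [triangularUpTo]
  | succ n ih =>
    rw [triangularUpTo, AlgEquiv.trans_apply, ih]
    by_cases h1 : rk m < n
    · rw [if_pos h1, blockShear_eq_self, if_pos (Nat.lt_succ_of_lt h1)]
      intro i hi
      rw [mem_rankLevel]
      rcases Finset.mem_union.mp (vars_add_subset _ _ hi) with h | h
      · rw [vars_X, Finset.mem_singleton] at h
        rw [h]
        exact h1.ne
      · exact (lt_trans (hrk m i h) h1).ne
    · rw [if_neg h1]
      by_cases h2 : rk m = n
      · rw [blockShear_X_of_mem _ ((mem_rankLevel rk).mpr h2), if_pos (by omega)]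
      · rw [blockShear_X_of_not_mem _ (fun h => h2 ((mem_rankLevel rk).mp h)), if_neg (by omega)]

/-- **The triangular automorphism** `Λ_N : X_m ↦ X_m + N_m` of a triangular correction family. (derived here)
[cite: CossartJannsenSaito2020, Def. 8.2 / Thm. 8.16] [cite: AbramovichTemkinWlodarczyk2024, Lemma 5.2.10 (p. 1577)] -/
def triangularEquiv (hrk : ∀ i, ∀ j ∈ (Nf i).vars, rk j < rk i) :
    MvPolynomial (Fin N) k ≃ₐ[k] MvPolynomial (Fin N) k :=
  triangularUpTo Nf rk hrk (Finset.univ.sup rk + 1)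

/-- `Λ_N (X_m) = X_m + N_m` for every slot. (derived here) [cite: CossartJannsenSaito2020, Def. 8.2 / Thm. 8.16] -/
theorem triangularEquiv_X (hrk : ∀ i, ∀ j ∈ (Nf i).vars, rk j < rk i) (m : Fin N) :
    triangularEquiv Nf rk hrk (X m) = X m + Nf m := by
  rw [triangularEquiv, triangularUpTo_X, if_pos]
  exact Nat.lt_succ_of_le (Finset.le_sup (f := rk) (Finset.mem_univ m))

end Triangular

/-! ## §2 Graded algebra maps -/

section Graded

variable (W : Fin N → ℕ)

/-- **A graded algebra map commutes with the homogeneous components**: if `φ (X_j)` is `W`-homogeneous of degree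
`W j` for every `j`, then `[φ P]_m = φ [P]_m`. (derived here)
[cite: AbramovichTemkinWlodarczyk2024, §3.4 (p. 1570), Lemma 5.2.10 (p. 1577)] -/
theorem weightedHomogeneousComponent_algHom_comm (φ : MvPolynomial (Fin N) k →ₐ[k] MvPolynomial (Fin N) k)
    (hφ : ∀ j, IsWeightedHomogeneous W (φ (X j)) (W j)) (P : MvPolynomial (Fin N) k) (m : ℕ) :
    weightedHomogeneousComponent W m (φ P) = φ (weightedHomogeneousComponent W m P) := by
  classical
  have hmono : ∀ (d : Fin N →₀ ℕ) (r : k), IsWeightedHomogeneous W (φ (monomial d r)) (weight W d) := by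
    intro d r
    rw [AlgHom.congr_fun (aeval_unique φ) (monomial d r)]
    exact isWeightedHomogeneous_aeval W _ hφ (isWeightedHomogeneous_monomial W d r rfl)
  conv_lhs => rw [P.as_sum]
  conv_rhs => rw [P.as_sum]
  simp only [map_sum]
  refine Finset.sum_congr rfl fun d _ => ?_
  rw [weightedHomogeneousComponent_of_mem (hmono d (coeff d P)),
    weightedHomogeneousComponent_of_mem (isWeightedHomogeneous_monomial W d (coeff d P) rfl)]
  split_ifs with h
  · rfl
  · rw [map_zero]

/-- The automorphism form of `weightedHomogeneousComponent_algHom_comm`. (derived here)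
[cite: AbramovichTemkinWlodarczyk2024, §3.4 (p. 1570)] -/
theorem weightedHomogeneousComponent_algEquiv_comm (Λ : MvPolynomial (Fin N) k ≃ₐ[k] MvPolynomial (Fin N) k)
    (hΛ : ∀ j, IsWeightedHomogeneous W (Λ (X j)) (W j)) (P : MvPolynomial (Fin N) k) (m : ℕ) :
    weightedHomogeneousComponent W m (Λ P) = Λ (weightedHomogeneousComponent W m P) :=
  weightedHomogeneousComponent_algHom_comm W (Λ : MvPolynomial (Fin N) k →ₐ[k] MvPolynomial (Fin N) k) hΛ P m

/-- **The inverse of a graded automorphism is graded**: if `Λ (X_j)` is `W`-homogeneous of degree `W j` for all `j`,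
so is `Λ⁻¹ (X_j)` (every other component of `Λ⁻¹ X_j` is killed by `Λ`, hence vanishes). (derived here)
[cite: AbramovichTemkinWlodarczyk2024, §3.4 (p. 1570), Lemma 5.2.10 (p. 1577)] -/
theorem isWeightedHomogeneous_algEquiv_symm_X (Λ : MvPolynomial (Fin N) k ≃ₐ[k] MvPolynomial (Fin N) k)
    (hΛ : ∀ j, IsWeightedHomogeneous W (Λ (X j)) (W j)) (j : Fin N) :
    IsWeightedHomogeneous W (Λ.symm (X j)) (W j) := by
  classical
  intro d hd
  by_contra hne
  have h0 : weightedHomogeneousComponent W (weight W d) (Λ.symm (X j)) = 0 := by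
    have h1 : Λ (weightedHomogeneousComponent W (weight W d) (Λ.symm (X j))) = 0 := by
      rw [← weightedHomogeneousComponent_algEquiv_comm W Λ hΛ, AlgEquiv.apply_symm_apply]
      exact (isWeightedHomogeneous_X k W j).weightedHomogeneousComponent_ne _ hne
    exact (map_eq_zero_iff Λ Λ.injective).mp h1
  have h2 := congrArg (coeff d) h0
  rw [coeff_weightedHomogeneousComponent, if_pos rfl, coeff_zero] at h2
  exact hd h2

/-- Consequently `Λ⁻¹` preserves the `W`-weight monomial by monomial: every monomial of `Λ⁻¹ (r X^d)` has the weight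
of `d`. (derived here) [cite: AbramovichTemkinWlodarczyk2024, §3.4 (p. 1570)] -/
theorem weight_eq_of_mem_support_algEquiv_symm (Λ : MvPolynomial (Fin N) k ≃ₐ[k] MvPolynomial (Fin N) k)
    (hΛ : ∀ j, IsWeightedHomogeneous W (Λ (X j)) (W j)) {d d' : Fin N →₀ ℕ} {r : k}
    (hd' : d' ∈ (Λ.symm (monomial d r)).support) : weight W d' = weight W d := by
  have hH : IsWeightedHomogeneous W (Λ.symm (monomial d r)) (weight W d) := by
    rw [algEquiv_eq_aeval₄₇ Λ.symm]
    exact isWeightedHomogeneous_aeval W _ (isWeightedHomogeneous_algEquiv_symm_X W Λ hΛ)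
      (isWeightedHomogeneous_monomial W d r rfl)
  exact hH (mem_support_iff.mp hd')

end Graded

/-! ## §3 The ND0 correction family -/

section Correction

variable (a b : Fin N) (c : k) (D : Fin N → ℕ) (Y : Fin N → MvPolynomial (Fin N) k)

/-- **The ND0 correction family.**  With `θ_Y i = [Y i]_{D i}` the maximal-rate parts and `A_i = θ_Y i − X_i` the
shifts, `N_i := A_i(t := −X_b/c)` for `i ∉ {a, b}` and `N_a = N_b = 0`: the new coordinates of E1 g30 LEMMA ND0 are
`ε''_i = ε_i + N_i`.  (`t := −X_b/c` is the absorber substitution `absorberSubst b a c⁻¹ 1`.) (derived here)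
[cite: Hauser2010, §D (p. 12)] [cite: AbramovichTemkinWlodarczyk2024, §5.1 (p. 1575)] -/
def pureCorrection : Fin N → MvPolynomial (Fin N) k :=
  fun i => if i = a then 0 else if i = b then 0 else
    aeval (absorberSubst b a c⁻¹ 1) (weightedHomogeneousComponent D (D i) (Y i) - X i)

/-- **The ND0 rank**: `2·D_j + [j ≠ b]` — the substituted slot `b` sits just below the other slots of its degree.
(derived here) [cite: CossartJannsenSaito2020, Def. 8.2 / Thm. 8.16] -/
def ndRank (b : Fin N) (D : Fin N → ℕ) : Fin N → ℕ := fun j => 2 * D j + if j = b then 0 else 1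

variable {a b c D Y}

/-- In inverse normal form every monomial of a shift `θ_Y i − X_i` (`i ≠ a`) is divisible by `t = X_a`. (derived here)
[cite: AbramovichTemkinWlodarczyk2024, §5.1 (p. 1575)] [cite: CossartJannsenSaito2020, Def. 1.26] -/
theorem apply_ne_zero_of_mem_support_top_sub_X (hY : IsInverseNormalForm a Y) (D : Fin N → ℕ) {i : Fin N}
    (hi : i ≠ a) {d : Fin N →₀ ℕ} (hd : d ∈ (weightedHomogeneousComponent D (D i) (Y i) - X i).support) :
    d a ≠ 0 := by
  classical
  obtain ⟨R, hR⟩ := hY.2 i hi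
  have hA : weightedHomogeneousComponent D (D i) (Y i) - X i = weightedHomogeneousComponent D (D i) (X a * R) := by
    rw [hR, map_add, weightedHomogeneousComponent_eq_self (isWeightedHomogeneous_X k D i), add_sub_cancel_left]
  rw [hA, mem_support_iff, coeff_weightedHomogeneousComponent] at hd
  split_ifs at hd with hw
  · have hd' : d ∈ (X a * R).support := mem_support_iff.mpr hd
    rw [support_X_mul] at hd'
    obtain ⟨e, -, rfl⟩ := Finset.mem_map.mp hd'
    rw [addLeftEmbedding_apply, Finsupp.add_apply, Finsupp.single_eq_same]
    omega
  · exact absurd rfl hd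

/-- A shift `[P]_{D i} − X_i` is `D`-homogeneous of degree `D i`. (derived here)
[cite: AbramovichTemkinWlodarczyk2024, §3.4 (p. 1570)] -/
theorem isWeightedHomogeneous_top_sub_X (D : Fin N → ℕ) (P : MvPolynomial (Fin N) k) (i : Fin N) :
    IsWeightedHomogeneous D (weightedHomogeneousComponent D (D i) P - X i) (D i) := by
  have h : weightedHomogeneousComponent D (D i) P - X i = weightedHomogeneousComponent D (D i) (P - X i) := by
    rw [map_sub, weightedHomogeneousComponent_eq_self (isWeightedHomogeneous_X k D i)]
  rw [h]
  exact weightedHomogeneousComponent_isWeightedHomogeneous _ _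

/-- **Support of the ND0 corrections**: off `{a, b}` every monomial of `N_i` is `t`-free and divisible by `X_b`
(each monomial `t^s ε^μ` of the shift, `s ≥ 1`, becomes `(−1/c)^s X_b^s ε^μ`). (derived here)
[cite: Hauser2010, §D (p. 12)] -/
theorem support_pureCorrection (hab : a ≠ b) (hY : IsInverseNormalForm a Y) {i : Fin N} (hia : i ≠ a)
    (hib : i ≠ b) {d' : Fin N →₀ ℕ} (hd' : d' ∈ (pureCorrection a b c D Y i).support) : d' a = 0 ∧ d' b ≠ 0 := by
  classical
  have hP : pureCorrection a b c D Y i =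
      aeval (absorberSubst b a c⁻¹ 1) (weightedHomogeneousComponent D (D i) (Y i) - X i) := by
    simp [pureCorrection, hia, hib]
  rw [hP, as_sum (weightedHomogeneousComponent D (D i) (Y i) - X i), map_sum] at hd'
  obtain ⟨d, hd, hdd'⟩ := Finset.mem_biUnion.mp (support_sum hd')
  rw [aeval_absorberSubst_monomial] at hdd'
  have hd'eq : d' = twistExp b a 1 d := Finset.mem_singleton.mp (support_monomial_subset hdd')
  have hda : d a ≠ 0 := apply_ne_zero_of_mem_support_top_sub_X hY D hia hd
  rw [hd'eq, twistExp_apply_absorber hab.symm, twistExp_apply_self hab.symm]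
  exact ⟨rfl, by omega⟩

/-- **The ND0 corrections are `D`-homogeneous**: `N_i ∈ V_{D i}` as soon as `D b = D a` (the substitution
`t ↦ −X_b/c` is then graded). (derived here) [cite: AbramovichTemkinWlodarczyk2024, §3.4 (p. 1570)] -/
theorem isWeightedHomogeneous_pureCorrection (hDab : D b = D a) (i : Fin N) :
    IsWeightedHomogeneous D (pureCorrection a b c D Y i) (D i) := by
  classical
  unfold pureCorrection
  split_ifs with hia hib
  · exact isWeightedHomogeneous_zero _ _ _
  · exact isWeightedHomogeneous_zero _ _ _
  · refine isWeightedHomogeneous_aeval D _ (fun j => ?_) (isWeightedHomogeneous_top_sub_X D (Y i) i)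
    by_cases hja : j = a
    · rw [hja, absorberSubst_self, C_mul_X_pow_eq_monomial, ← map_neg, ← hDab]
      exact isWeightedHomogeneous_monomial D _ _ (by rw [Finsupp.weight_single, one_smul])
    · rw [absorberSubst_of_ne hja]
      exact isWeightedHomogeneous_X k D j

/-- **The ND0 corrections are triangular for `ndRank`**: a variable `X_j` of `N_i` has `ndRank j < ndRank i` — each
monomial of `N_i` has degree `D i` and contains `X_b` (degree `D b = D a ≥ 1`), so its other variables have degree
`< D i`, and `b` itself is ranked just below the slots of degree `≥ D b`. (derived here)
[cite: CossartJannsenSaito2020, Def. 8.2 / Thm. 8.16] [cite: Hauser2010, §D (p. 12)] -/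
theorem ndRank_lt_of_mem_vars_pureCorrection (hab : a ≠ b) (hY : IsInverseNormalForm a Y) (hDab : D b = D a)
    (hDa : 0 < D a) {i j : Fin N} (hj : j ∈ (pureCorrection a b c D Y i).vars) :
    ndRank b D j < ndRank b D i := by
  classical
  by_cases hia : i = a
  · have h0 : pureCorrection a b c D Y i = 0 := by simp [pureCorrection, hia]
    rw [h0, vars_0] at hj
    exact absurd hj (Finset.notMem_empty j)
  by_cases hib : i = b
  · have h0 : pureCorrection a b c D Y i = 0 := by simp [pureCorrection, hib, hab.symm]
    rw [h0, vars_0] at hj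
    exact absurd hj (Finset.notMem_empty j)
  obtain ⟨d', hd', hjd'⟩ := (mem_vars_iff_mem_support j).mp hj
  obtain ⟨-, hd'b⟩ := support_pureCorrection hab hY hia hib hd'
  have hw : weight D d' = D i := isWeightedHomogeneous_pureCorrection hDab i (mem_support_iff.mp hd')
  have hsplit : weight D d' = weight D (d'.erase b) + d' b * D b := by
    conv_lhs => rw [← Finsupp.erase_add_single b d']
    rw [map_add, Finsupp.weight_single, smul_eq_mul]
  obtain ⟨P, hP⟩ : ∃ P, d' b * D b = P := ⟨_, rfl⟩
  have h2 : D b ≤ P := hP ▸ Nat.le_mul_of_pos_left _ (Nat.pos_of_ne_zero hd'b)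
  rw [hP] at hsplit
  have hjd : d' j ≠ 0 := Finsupp.mem_support_iff.mp hjd'
  unfold ndRank
  by_cases hjb : j = b
  · rw [if_pos hjb, if_neg hib, hjb]
    omega
  · rw [if_neg hjb, if_neg hib]
    have h1 : D j ≤ weight D (d'.erase b) := by
      apply Finsupp.le_weight_of_ne_zero'
      rwa [Finsupp.erase_ne hjb]
    omega

end Correction

/-! ## §4 THEOREM ND0 in the model -/

section Model

/-- **THEOREM ND0 (no pure translation / "no depth-0 absorber") in the `W(f)` model.**  Let `(Ψ, w)` be a centre for
`f = X_a^q + h` (`h` free of `X_a`, `q ≥ 1`) attaining `max W(f)`, with `Y i = Ψ⁻¹ Xᵢ` in inverse normal form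
relative to `a`; let `D` be the θ-grading (`D a = L > 0`, `D_i θ = L w_i`, `E₀ θ = L`, `w_a < θ`) dominated by `Y`,
and assume the centre is NOT `T`-tight (`1 < q θ`).  If the maximal-rate part of some coordinate is a pure translate,
`[Y b]_{D b} = X_b + c·X_a` (`b ≠ a`), then `c = 0`.
Proof: if `c ≠ 0` then `D b = D a` (`w_b = θ`); Lemma Q gives `h₀(θ_Y) = h₀` for the face `h₀ = [h]_{E₀}`;
substituting `t ↦ −X_b/c` yields `h₀ = Λ (h₀|_{X_b = 0})` for the triangular automorphism `Λ : X_i ↦ X_i + N_i` of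
the ND0 correction family (§1, §3); `(Λ ∘ Ψ, w)` is again a centre for `f` (origin: the `N_i` have no constant term;
admissibility: `Λ⁻¹` is graded for `D` and for the `t`-degree, §2, and `v_w` is a function of the two degrees), with
the same invariant, whose `E₀`-face `Λ⁻¹ h₀ = h₀|_{X_b = 0}` has no monomial through `X_b` — contradicting the upper
pin of `b` (`w_b = θ > 0`) at a maximal centre (`exists_upperPin_of_isMaxInv`). (derived here)
[cite: AbramovichTemkinWlodarczyk2024, Thm. 5.3.1 (2) (p. 1578), Lemma 5.2.10 (p. 1577), Def. 2.4.1 (2) (p. 1568)]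
[cite: Hauser2010, §D (p. 12)] [cite: AbramovichQuekSchober2025, Thm. 3.5] -/
theorem eq_zero_of_top_eq_pure_translation {Ψ : MvPolynomial (Fin N) k ≃ₐ[k] MvPolynomial (Fin N) k}
    {a b : Fin N} (hab : a ≠ b) (hY : IsInverseNormalForm a (fun i => Ψ.symm (X i)))
    {h : MvPolynomial (Fin N) k} (hh : a ∉ h.vars) {q : ℕ} (hq : 0 < q) {w : Fin N → ℚ}
    (hcen : IsCentreFor (X a ^ q + h) Ψ w) (hmax : IsMaxInv (admissibleInvariants (X a ^ q + h)) (exps w))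
    (θ : ℚ) (L : ℕ) (D : Fin N → ℕ) (hL : 0 < L) (hDa : D a = L)
    (hD : ∀ i, i ≠ a → (D i : ℚ) * θ = L * w i) {E₀ : ℕ} (hE₀ : (E₀ : ℚ) * θ = L) (hθ : w a < θ)
    (hqθ : 1 < (q : ℚ) * θ) (hdom : ∀ i, (D i : ℕ∞) ≤ monomialOrd D (Ψ.symm (X i))) {c : k}
    (htop : weightedHomogeneousComponent D (D b) (Ψ.symm (X b)) = X b + C c * X a) : c = 0 := by
  classical
  by_contra hc
  set Y : Fin N → MvPolynomial (Fin N) k := fun i => Ψ.symm (X i) with hYdef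
  have htop' : weightedHomogeneousComponent D (D b) (Y b) = X b + C c * X a := htop
  have hdom' : ∀ i, (D i : ℕ∞) ≤ monomialOrd D (Y i) := hdom
  have hwa : 0 ≤ w a := hcen.2.1 a
  have hθpos : 0 < θ := lt_of_le_of_lt hwa hθ
  have hL' : (0 : ℚ) < L := by exact_mod_cast hL
  -- (i) the shifted slot has degree `D a` and weight `θ`
  have hDab : D b = D a := by
    have h1 : weightedHomogeneousComponent D (D b) (Y b) = X b + C c * X a ^ 1 := by rw [pow_one]; exact htop'
    have h2 := weight_eq_of_top_absorber hab hc D h1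
    omega
  have hwb : w b = θ := by
    have h1 := hD b hab.symm
    rw [hDab, hDa] at h1
    have h2 : (L : ℚ) * w b = L * θ := by rw [← h1, mul_comm]
    exact mul_left_cancel₀ hL'.ne' h2
  have hwb0 : 0 < w b := hwb ▸ hθpos
  have hDa0 : 0 < D a := hDa ▸ hL
  -- (ii) Lemma Q: the face is fixed by the maximal-rate parts
  have hF : Ψ.symm (X a ^ q + h) = X a ^ q + aeval Y h :=
    (algEquiv_symm_eq_aeval Ψ _).trans (hY.aeval_X_pow_add q h)
  have hadm : IsAdmissibleFor w (X a ^ q + aeval Y h) := hF ▸ hcen.2.2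
  have hind : ¬ (q * L = E₀) := by
    intro hqe
    have h1 : (q : ℚ) * θ * L = 1 * L := by
      rw [one_mul]
      nth_rewrite 2 [← hE₀]
      rw [← hqe, Nat.cast_mul]
      ring
    have h2 : (q : ℚ) * θ = 1 := mul_right_cancel₀ hL'.ne' h1
    linarith
  have hface : aeval (fun i => weightedHomogeneousComponent D (D i) (Y i)) (weightedHomogeneousComponent D E₀ h) =
      weightedHomogeneousComponent D E₀ h := by
    have h1 := hY.face_equation w θ L D hL hDa hD hθ hwa hE₀ hdom' hh hq hadm
    simpa [hind] using h1
  set Φ := weightedHomogeneousComponent D E₀ h with hΦdef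
  have hΦa : a ∉ Φ.vars := notMem_vars_weightedHomogeneousComponent₄₇ hh D E₀
  -- (iii) the correction family and its triangular automorphism
  have hrk : ∀ i, ∀ j ∈ (pureCorrection a b c D Y i).vars, ndRank b D j < ndRank b D i :=
    fun i j hj => ndRank_lt_of_mem_vars_pureCorrection hab hY hDab hDa0 hj
  set Nf := pureCorrection a b c D Y with hNfdef
  set Λ := triangularEquiv Nf (ndRank b D) hrk with hΛdef
  have hΛX : ∀ m, Λ (X m) = X m + Nf m := triangularEquiv_X Nf (ndRank b D) hrk
  have hNa : Nf a = 0 := by simp [hNfdef, pureCorrection]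
  have hNb : Nf b = 0 := by simp [hNfdef, pureCorrection, hab.symm]
  have hNsupp : ∀ i, ∀ d' ∈ (Nf i).support, d' a = 0 ∧ d' b ≠ 0 := by
    intro i d' hd'
    by_cases hia : i = a
    · rw [hia, hNa] at hd'
      simp at hd'
    by_cases hib : i = b
    · rw [hib, hNb] at hd'
      simp at hd'
    exact support_pureCorrection hab hY hia hib hd'
  have hNhom : ∀ i, IsWeightedHomogeneous D (Nf i) (D i) :=
    fun i => isWeightedHomogeneous_pureCorrection hDab i
  have hΛD : ∀ j, IsWeightedHomogeneous D (Λ (X j)) (D j) := fun j => by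
    rw [hΛX]
    exact (isWeightedHomogeneous_X k D j).add (hNhom j)
  have hΛt : ∀ j, IsWeightedHomogeneous (tIndicator a) (Λ (X j)) (tIndicator a j) := fun j => by
    rw [hΛX]
    refine (isWeightedHomogeneous_X k (tIndicator a) j).add ?_
    intro d' hd'
    have hja : j ≠ a := by
      rintro rfl
      rw [hNa, coeff_zero] at hd'
      exact hd' rfl
    rw [weight_tIndicator, (hNsupp j d' (mem_support_iff.mpr hd')).1]
    simp [tIndicator, hja]
  -- (iv) the key identity `Λ (Φ|_{X_b = 0}) = Φ`
  have hkey : Λ (killHom {b} Φ) = Φ := by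
    have h1 : aeval (fun i => aeval (absorberSubst b a c⁻¹ 1) (weightedHomogeneousComponent D (D i) (Y i))) Φ = Φ := by
      have h2 := congrArg (aeval (absorberSubst b a c⁻¹ 1)) hface
      rw [comp_aeval_apply] at h2
      rw [h2]
      exact aeval_eq_self_of_vars₄₇ _ (fun i hi => absorberSubst_of_ne (fun hia => hΦa (hia ▸ hi)))
    have h3 : aeval (fun i => if i = b then (0 : MvPolynomial (Fin N) k) else Λ (X i)) Φ = Φ := by
      refine (aeval_congr_vars₄₇ _ _ fun i hi => ?_).trans h1
      have hia : i ≠ a := fun hia => hΦa (hia ▸ hi)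
      by_cases hib : i = b
      · rw [if_pos hib, hib, htop', map_add, map_mul, aeval_X, aeval_X, aeval_C, MvPolynomial.algebraMap_eq,
          absorberSubst_of_ne hab.symm, absorberSubst_self, pow_one, mul_neg, ← mul_assoc, ← C_mul,
          mul_inv_cancel₀ hc, C_1, one_mul, add_neg_cancel]
      · rw [if_neg hib, hΛX, hNfdef]
        simp only [pureCorrection, if_neg hia, if_neg hib]
        rw [map_sub, aeval_X, absorberSubst_of_ne hia, add_sub_cancel]
    calc Λ (killHom {b} Φ) = aeval (fun i => Λ (if i ∈ ({b} : Finset (Fin N)) then 0 else X i)) Φ := by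
          rw [killHom]
          exact algEquiv_aeval₄₇ Λ _ Φ
      _ = aeval (fun i => if i = b then (0 : MvPolynomial (Fin N) k) else Λ (X i)) Φ := by
          have hG : (fun i => Λ (if i ∈ ({b} : Finset (Fin N)) then 0 else X i)) =
              (fun i => if i = b then (0 : MvPolynomial (Fin N) k) else Λ (X i)) := by
            funext i
            by_cases hib : i = b
            · rw [if_pos (Finset.mem_singleton.mpr hib), if_pos hib, map_zero]
            · rw [if_neg (fun h => hib (Finset.mem_singleton.mp h)), if_neg hib]
          rw [hG]
      _ = Φ := h3
  -- (v) the new centre `(Λ ∘ Ψ, w)`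
  have hcen' : IsCentreFor (X a ^ q + h) (Λ.trans Ψ) w := by
    refine ⟨fun i => ?_, hcen.2.1, ?_⟩
    · rw [AlgEquiv.trans_apply, constantCoeff_map₄₇ Ψ hcen.1, hΛX, map_add, constantCoeff_X, zero_add]
      by_contra hne
      have h0 : (0 : Fin N →₀ ℕ) ∈ (Nf i).support := by
        rw [mem_support_iff]
        exact hne
      exact (hNsupp i 0 h0).2 rfl
    · rw [AlgEquiv.symm_trans_apply, hF]
      intro d' hd'
      rw [as_sum (X a ^ q + aeval Y h), map_sum] at hd'
      obtain ⟨d, hd, hdd'⟩ := Finset.mem_biUnion.mp (support_sum hd')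
      have hwD : weight D d' = weight D d := weight_eq_of_mem_support_algEquiv_symm D Λ hΛD hdd'
      have hwt : weight (tIndicator a) d' = weight (tIndicator a) d :=
        weight_eq_of_mem_support_algEquiv_symm _ Λ hΛt hdd'
      rw [weight_tIndicator, weight_tIndicator] at hwt
      have h1 := theta_mul_weight w θ L D hDa hD d
      have h2 := theta_mul_weight w θ L D hDa hD d'
      rw [hwD, hwt] at h2
      have h4 : (L : ℚ) * (monomialValuation w d' + d a * (θ - w a)) =
          L * (monomialValuation w d + d a * (θ - w a)) := by rw [← h2, h1]
      have h5 := mul_left_cancel₀ hL'.ne' h4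
      have h3 : monomialValuation w d' = monomialValuation w d := by linarith
      rw [h3]
      exact hadm d hd
  -- (vi) the `E₀`-face of the new centre is `Φ|_{X_b = 0}`
  have hE : (E₀ : ℕ∞) ≤ monomialOrd D h :=
    le_monomialOrd_of_isAdmissibleFor_of_notMem_vars w θ L D hL hDa hD hθpos hE₀ hh
      (hY.isAdmissibleFor_of_aeval hq hh hadm)
  have hfaceF : weightedHomogeneousComponent D E₀ (X a ^ q + aeval Y h) = Φ := by
    have h1 : weightedHomogeneousComponent D E₀ (aeval Y h) =
        aeval (fun i => weightedHomogeneousComponent D (D i) (Y i)) Φ := by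
      have := weightedHomogeneousComponent_map_of_le_monomialOrd D (aeval Y)
        (fun i => by rw [aeval_X]; exact hdom' i) h hE
      simpa only [aeval_X] using this
    rw [map_add, weightedHomogeneousComponent_X_pow, if_neg (by rw [hDa]; exact hind), zero_add, h1, hface]
  have hfaceF' : weightedHomogeneousComponent D E₀ (Λ.symm (X a ^ q + aeval Y h)) = killHom {b} Φ := by
    rw [weightedHomogeneousComponent_algEquiv_comm D Λ.symm (isWeightedHomogeneous_algEquiv_symm_X D Λ hΛD),
      hfaceF]
    exact (AlgEquiv.symm_apply_eq Λ).mpr hkey.symm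
  -- (vii) the upper pin of `b` at the maximal new centre: contradiction
  obtain ⟨d, hdF, hv1, hdb, hmin⟩ := exists_upperPin_of_isMaxInv hcen' hmax hwb0
  rw [AlgEquiv.symm_trans_apply, hF] at hdF
  have hda : d a = 0 := by
    by_contra hne
    have := hmin a hne
    linarith
  have hwd : weight D d = E₀ := by
    have h1 := theta_mul_weight w θ L D hDa hD d
    rw [hv1, hda, Nat.cast_zero, zero_mul, add_zero, mul_one] at h1
    have h2 : ((weight D d : ℕ) : ℚ) * θ = (E₀ : ℚ) * θ := by rw [hE₀]; linarith
    exact_mod_cast mul_right_cancel₀ hθpos.ne' h2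
  have hcoef : coeff d (killHom {b} Φ) ≠ 0 := by
    rw [← hfaceF', coeff_weightedHomogeneousComponent, if_pos hwd]
    exact mem_support_iff.mp hdF
  exact hcoef (coeff_killHom_of_ne_zero (Finset.mem_singleton_self b) hdb Φ)

/-- **COROLLARY (engine 1's step (1) of THEOREM R: the twist is a genuine Frobenius twist, `S ≥ 2`).**  In the
setting of `twistDepth_mul_theta_le_one` — a centre of `X_a^q + h` attaining `max W(f)`, inverse normal form,
θ-grading dominated by `Y`, not `T`-tight — an absorber top part `[Y b]_{D b} = X_b + c·X_a^S` with `c ≠ 0` and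
`S ≥ 1` has `S ≥ 2`: the case `S = 1` is a pure translation, excluded by `eq_zero_of_top_eq_pure_translation`.
(With `S = p^k` this is E1's "`k ≥ 1`".) (derived here)
[cite: AbramovichTemkinWlodarczyk2024, Thm. 5.3.1 (2) (p. 1578)] [cite: Hauser2010, §D (p. 12)] -/
theorem two_le_of_top_absorber {Ψ : MvPolynomial (Fin N) k ≃ₐ[k] MvPolynomial (Fin N) k}
    {a b : Fin N} (hab : a ≠ b) (hY : IsInverseNormalForm a (fun i => Ψ.symm (X i)))
    {h : MvPolynomial (Fin N) k} (hh : a ∉ h.vars) {q : ℕ} (hq : 0 < q) {w : Fin N → ℚ}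
    (hcen : IsCentreFor (X a ^ q + h) Ψ w) (hmax : IsMaxInv (admissibleInvariants (X a ^ q + h)) (exps w))
    (θ : ℚ) (L : ℕ) (D : Fin N → ℕ) (hL : 0 < L) (hDa : D a = L)
    (hD : ∀ i, i ≠ a → (D i : ℚ) * θ = L * w i) {E₀ : ℕ} (hE₀ : (E₀ : ℚ) * θ = L) (hθ : w a < θ)
    (hqθ : 1 < (q : ℚ) * θ) (hdom : ∀ i, (D i : ℕ∞) ≤ monomialOrd D (Ψ.symm (X i))) {c : k} (hc : c ≠ 0)
    {S : ℕ} (hS : 1 ≤ S) (htop : weightedHomogeneousComponent D (D b) (Ψ.symm (X b)) = X b + C c * X a ^ S) :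
    2 ≤ S := by
  by_contra hlt
  have hS1 : S = 1 := by omega
  rw [hS1, pow_one] at htop
  exact hc (eq_zero_of_top_eq_pure_translation hab hY hh hq hcen hmax θ L D hL hDa hD hE₀ hθ hqθ hdom htop)

end Model

end WeightedBlowup

end Literature.AlgebraicGeometry.Resolution
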